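import Summits.MatrixMultiplication.OmegaCensus.DicyclicQuotientDescent
import Summits.MatrixMultiplication.OmegaCensus.DicyclicLawQuotientCyclic
import Literature.Combinatorics.Additive.TPPGroupAlgebra
import HarnessLib

/-!
# The `|A| ≡ 2 (mod 3)` dicyclic classification reduced to a stability statement

ω-census `pub-omega`, family (b3), seat pub-omega-group gen 11.  Framing: lottery ticket; floor = certified bounds/negative
ranges.  VALUE: kernel theorems about the group-theoretic method (TPP capacity of dihedral-like groups); NOT progress on ω.

Dicyclic type `G(A, c₀)` (`c₀ ≠ 0`), `|A| ≡ 2 (mod 3)`, `|A| ≥ 28`, and `A/⟨c₀⟩` maps onto `𝔽₂³` (three homomorphisms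
`A →+ ZMod 2` killing `c₀`, jointly onto) — the situation of the open census families `C₂² × Q_{4m}` (`m ≡ 4 (mod 6)`),
`C₂² × (ℤ_n ⋊ ℤ₄)` (`n ≡ 4 (mod 6)`), `C₂³ × Q_{4m}` (`m ≡ 2 (mod 3)`).

**Theorem (`no_dicyclic_law_of_stable_member`).** A TPP triple `(S, T, U)` one of whose members is stable under right
multiplication by a central involution `ρ(a)` (`2a = 0 ≠ a`; any such `a`, not only `c₀`) does NOT attain the dicyclic law
`3|S||T||U| + 16 = 8|A|`.

*Proof.* Rotate the stable member into third position and descend along `a` (`tpp_descend`, `DicyclicQuotientDescent`):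
`G(A/⟨a⟩, c̄₀)` gets a TPP triple of half the volume, i.e. attaining the mod-one law `3V' + 8 = 8|A/⟨a⟩|`.  If `a = c₀` this
group is `Dih(A/⟨c₀⟩)` with `A/⟨c₀⟩ ↠ 𝔽₂³` — impossible by `no_mod_one_law_of_rank_three`.  If `a ≠ c₀` then `c̄₀ ≠ 0` and by
`quot_cyclic_of_mod_one_law_of_c0_ne_zero` (gen 8) `A/⟨a, c₀⟩` is cyclic, so `A` is the union of the four cosets
`{0, a, c₀, a + c₀} + ⟨g⟩`; a homomorphism to `𝔽₂³` killing `c₀` then takes at most four values — not onto.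

So the open half ('dicyclic law ⟹ `A/⟨c₀⟩` has a cyclic subgroup of index `≤ 2`') of the `|A| ≡ 2 (mod 3)` classification is
REDUCED to the stability statement (H): *every dicyclic-law triple has a member stable under some central involution `ρ(a)`*.
(H) is a theorem for two-domino triples (saturation, `two_domino_volume_le_double`), and holds for every dicyclic-law triple of
the order-40 groups `Q₄₀`, `ℤ₁₀ ⋊ ℤ₄`, `C₂ × Q₂₀` by exhaustive enumeration (seat pub-omega-group-g11, `code/hstar_test.py`; the
involution is NOT always `c₀`).  `no_dicyclic_law_of_two_domino'` re-derives the two-domino case from the reduction.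
-/

namespace Summit.MatrixMultiplication.OmegaCensus

open Literature.Combinatorics.Additive Finset

section Reduction

variable {A : Type} [AddCommGroup A] [DecidableEq A] [Fintype A] {G : Type} [Group G] [DecidableEq G]
  {ρ τ : A → G} {c₀ : A}

omit [DecidableEq A] [Fintype A] in
/-- A homomorphism to `𝔽₂³` that kills `c` and sees `A` inside the four cosets `{0, a, −c, a − c} + ⟨g⟩` takes at most four
values, so it is not onto. [folklore] -/
theorem psi_not_onto_of_four_cosets {g a c : A} (ψ₁ ψ₂ ψ₃ : A →+ ZMod 2) (hc : ψ₁ c = 0 ∧ ψ₂ c = 0 ∧ ψ₃ c = 0)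
    (hcov : ∀ x : A, x ∈ AddSubgroup.zmultiples g ∨ x - a ∈ AddSubgroup.zmultiples g ∨
      x + c ∈ AddSubgroup.zmultiples g ∨ x + c - a ∈ AddSubgroup.zmultiples g)
    (hψ : ∀ v : ZMod 2 × ZMod 2 × ZMod 2, ∃ x, (ψ₁ x, ψ₂ x, ψ₃ x) = v) : False := by
  let Ψ : A →+ ZMod 2 × ZMod 2 × ZMod 2 := (ψ₁.prod (ψ₂.prod ψ₃))
  have hΨ : ∀ x, Ψ x = (ψ₁ x, ψ₂ x, ψ₃ x) := fun x => rfl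
  have hΨc : Ψ c = 0 := by rw [hΨ, hc.1, hc.2.1, hc.2.2]; rfl
  have hmul : ∀ (u : ZMod 2 × ZMod 2 × ZMod 2) (k : ℤ), k • u = 0 ∨ k • u = u := by
    intro u k
    rw [← Int.cast_smul_eq_zsmul (ZMod 2) k u]
    have hk : ((k : ZMod 2) = 0) ∨ ((k : ZMod 2) = 1) := by
      generalize (k : ZMod 2) = z; fin_cases z; exacts [Or.inl rfl, Or.inr rfl]
    rcases hk with hk | hk <;> rw [hk]
    · exact Or.inl (zero_smul _ u)
    · exact Or.inr (one_smul _ u)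
  -- every value of `Ψ` is one of four vectors
  have himg : ∀ x, Ψ x = 0 ∨ Ψ x = Ψ g ∨ Ψ x = Ψ a ∨ Ψ x = Ψ a + Ψ g := by
    intro x
    have key : ∀ y b : A, y - b ∈ AddSubgroup.zmultiples g → Ψ y = Ψ b ∨ Ψ y = Ψ b + Ψ g := by
      intro y b hy
      obtain ⟨k, hk⟩ := AddSubgroup.mem_zmultiples_iff.1 hy
      have e : Ψ y = Ψ b + k • Ψ g := by rw [← map_zsmul, hk, map_sub]; abel
      rcases hmul (Ψ g) k with h0 | h1
      · left; rw [e, h0, add_zero]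
      · right; rw [e, h1]
    rcases hcov x with hx | hx | hx | hx
    · rcases key x 0 (by rw [sub_zero]; exact hx) with e | e <;> rw [e, map_zero]
      · exact Or.inl rfl
      · exact Or.inr (Or.inl (zero_add _))
    · rcases key x a hx with e | e
      · exact Or.inr (Or.inr (Or.inl e))
      · exact Or.inr (Or.inr (Or.inr e))
    · rcases key (x + c) 0 (by rw [sub_zero]; exact hx) with e | e <;> rw [map_add, hΨc, add_zero, map_zero] at e
      · exact Or.inl e
      · exact Or.inr (Or.inl (by rw [e, zero_add]))
    · rcases key (x + c) a hx with e | e <;> rw [map_add, hΨc, add_zero] at e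
      · exact Or.inr (Or.inr (Or.inl e))
      · exact Or.inr (Or.inr (Or.inr e))
  set F : Finset (ZMod 2 × ZMod 2 × ZMod 2) := {0, Ψ g, Ψ a, Ψ a + Ψ g} with hF
  have hFcard : F.card ≤ 4 := by
    rw [hF]
    refine (card_insert_le _ _).trans ?_
    refine (Nat.succ_le_succ (card_insert_le _ _)).trans ?_
    refine (Nat.succ_le_succ (Nat.succ_le_succ (card_insert_le _ _))).trans ?_
    rw [card_singleton]
  have huniv : (univ : Finset (ZMod 2 × ZMod 2 × ZMod 2)).card = 8 := by
    rw [card_univ]; simp [Fintype.card_prod, ZMod.card]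
  have hns : ¬ ((univ : Finset (ZMod 2 × ZMod 2 × ZMod 2)) ⊆ F) := fun hsub => by
    have := card_le_card hsub; omega
  obtain ⟨v, -, hv⟩ := not_subset.1 hns
  obtain ⟨x, hx⟩ := hψ v
  rw [← hΨ] at hx
  apply hv
  rw [hF, ← hx]
  rcases himg x with e | e | e | e <;> rw [e] <;> simp

omit [DecidableEq A] [Fintype A] in
/-- The kernel computation for the quotient by an involution: `x ∈ ⟨a⟩ ⟺ x ∈ {0, a}` when `2a = 0`. [folklore] -/
theorem mem_zmultiples_of_two {a : A} (ha2 : a + a = 0) (x : A) :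
    x ∈ AddSubgroup.zmultiples a ↔ x = 0 ∨ x = a := by
  constructor
  · intro hx
    obtain ⟨k, hk⟩ := AddSubgroup.mem_zmultiples_iff.1 hx
    have hjj : ∀ j : ℤ, j • a + j • a = 0 := fun j => by rw [← zsmul_add, ha2, zsmul_zero]
    rcases Int.even_or_odd k with ⟨j, rfl⟩ | ⟨j, rfl⟩
    · left; rw [← hk, add_zsmul, hjj]
    · right; rw [← hk, add_zsmul, one_zsmul, two_mul, add_zsmul, hjj, zero_add]
  · rintro (h0 | h0) <;> rw [h0]
    · exact (AddSubgroup.zmultiples a).zero_mem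
    · exact AddSubgroup.mem_zmultiples a

/-- **Core of the reduction: a dicyclic-law triple cannot have a `ρ(a)`-stable third member** (`2a = 0 ≠ a`; dicyclic type,
`|A| ≡ 2 (mod 3)`, `|A| ≥ 28`, `A/⟨c₀⟩ ↠ 𝔽₂³`). [folklore] -/
theorem no_dicyclic_law_of_stable_third
    (hρρ : ∀ a b, ρ a * ρ b = ρ (a + b)) (hρτ : ∀ a b, ρ a * τ b = τ (b - a))
    (hτρ : ∀ a b, τ a * ρ b = τ (a + b)) (hττ : ∀ a b, τ a * τ b = ρ (c₀ + b - a)) (hc₀ : c₀ ≠ 0)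
    (hρ : Function.Injective ρ) (hτ : Function.Injective τ) (hne : ∀ a b, ρ a ≠ τ b)
    (hsurj : ∀ g, (∃ a, ρ a = g) ∨ (∃ a, τ a = g)) (hmod : Fintype.card A % 3 = 2) (hA : 28 ≤ Fintype.card A)
    (ψ₁ ψ₂ ψ₃ : A →+ ZMod 2) (hψc : ψ₁ c₀ = 0 ∧ ψ₂ c₀ = 0 ∧ ψ₃ c₀ = 0)
    (hψ : ∀ v : ZMod 2 × ZMod 2 × ZMod 2, ∃ x, (ψ₁ x, ψ₂ x, ψ₃ x) = v)
    {S T U : Finset G} (h : TripleProductProperty S T U)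
    {a : A} (ha2 : a + a = 0) (ha0 : a ≠ 0) (hUa : ∀ u ∈ U, u * ρ a ∈ U) :
    3 * (S.card * T.card * U.card) + 16 ≠ 8 * Fintype.card A := by
  intro hV
  classical
  have h2c₀ : c₀ + c₀ = 0 := two_c0_eq_zero hρτ hτρ hττ hτ
  -- non-emptiness
  have hpos : 0 < S.card * T.card * U.card := by
    by_contra h0; push Not at h0
    have : S.card * T.card * U.card = 0 := by omega
    omega
  have hS : S.Nonempty := card_pos.1 (Nat.pos_of_ne_zero fun h0 => by rw [h0] at hpos; simp at hpos)
  have hT : T.Nonempty := card_pos.1 (Nat.pos_of_ne_zero fun h0 => by rw [h0] at hpos; simp at hpos)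
  have hU : U.Nonempty := card_pos.1 (Nat.pos_of_ne_zero fun h0 => by rw [h0] at hpos; simp at hpos)
  -- the quotient by `⟨a⟩`
  let K : AddSubgroup A := AddSubgroup.zmultiples a
  let π : A →+ A ⧸ K := QuotientAddGroup.mk' K
  have hker : ∀ x : A, π x = 0 ↔ x = 0 ∨ x = a := by
    intro x
    rw [QuotientAddGroup.mk'_apply, QuotientAddGroup.eq_zero_iff]
    exact mem_zmultiples_of_two ha2 x
  have hπsurj : Function.Surjective π := QuotientAddGroup.mk'_surjective K
  set c₀' : A ⧸ K := π c₀ with hc₀'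
  haveI : Fact (c₀' + c₀' = 0) := ⟨by rw [hc₀', ← map_add, h2c₀, map_zero]⟩
  have hcard : Fintype.card A = 2 * Fintype.card (A ⧸ K) := card_eq_two_mul_of_ker_pair π hπsurj ha0 hker
  obtain ⟨S', T', U', h', cS, cT, cU, -, -, -⟩ :=
    tpp_descend (c₀' := c₀') hρρ hρτ hτρ hττ hρ hτ hne hsurj ha2 ha0 π rfl hker h hS hT hU hUa
  have hvol : S.card * T.card * U.card = 2 * (S'.card * T'.card * U'.card) := by
    rw [← cS, ← cT, ← cU]; ring
  have hV' : 3 * (S'.card * T'.card * U'.card) + 8 = 8 * Fintype.card (A ⧸ K) := by omega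
  have hmodB : Fintype.card (A ⧸ K) % 3 = 1 := by omega
  have hB : 14 ≤ Fintype.card (A ⧸ K) := by omega
  by_cases hac : a = c₀
  · -- `a = c₀`: the quotient is `Dih(A/⟨c₀⟩)` over a group mapping onto `𝔽₂³`
    have hle : ∀ ψ : A →+ ZMod 2, ψ c₀ = 0 → K ≤ ψ.ker := by
      intro ψ hψ0
      refine AddSubgroup.zmultiples_le.2 ?_
      rw [AddMonoidHom.mem_ker, hac]; exact hψ0
    let φ₁ : A ⧸ K →+ ZMod 2 := QuotientAddGroup.lift K ψ₁ (hle ψ₁ hψc.1)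
    let φ₂ : A ⧸ K →+ ZMod 2 := QuotientAddGroup.lift K ψ₂ (hle ψ₂ hψc.2.1)
    let φ₃ : A ⧸ K →+ ZMod 2 := QuotientAddGroup.lift K ψ₃ (hle ψ₃ hψc.2.2)
    have hφ : ∀ v : ZMod 2 × ZMod 2 × ZMod 2, ∃ y : A ⧸ K, (φ₁ y, φ₂ y, φ₃ y) = v := by
      intro v
      obtain ⟨x, hx⟩ := hψ v
      exact ⟨π x, by rw [← hx]; rfl⟩
    exact no_mod_one_law_of_rank_three (A := A ⧸ K) (G := DihedralLikeGroup (A ⧸ K) c₀')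
      (ρ := DihedralLikeGroup.rho) (τ := DihedralLikeGroup.tau) (c₀ := c₀')
      DihedralLikeGroup.rho_mul_rho DihedralLikeGroup.rho_mul_tau DihedralLikeGroup.tau_mul_rho
      DihedralLikeGroup.tau_mul_tau DihedralLikeGroup.rho_injective DihedralLikeGroup.tau_injective
      DihedralLikeGroup.rho_ne_tau DihedralLikeGroup.rho_or_tau hB φ₁ φ₂ φ₃ hφ h' hV'
  · -- `a ≠ c₀`: the quotient is dicyclic with `c̄₀ ≠ 0`, so its law forces `A/⟨a, c₀⟩` cyclic
    have hc₀'ne : c₀' ≠ 0 := by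
      intro h0
      rcases (hker c₀).1 h0 with h1 | h1
      · exact hc₀ h1
      · exact hac h1.symm
    obtain ⟨gbar, hgbar⟩ := quot_cyclic_of_mod_one_law_of_c0_ne_zero (A := A ⧸ K) (G := DihedralLikeGroup (A ⧸ K) c₀')
      (ρ := DihedralLikeGroup.rho) (τ := DihedralLikeGroup.tau) (c₀ := c₀')
      DihedralLikeGroup.rho_mul_rho DihedralLikeGroup.rho_mul_tau DihedralLikeGroup.tau_mul_rho
      DihedralLikeGroup.tau_mul_tau hc₀'ne DihedralLikeGroup.rho_injective DihedralLikeGroup.tau_injective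
      DihedralLikeGroup.rho_ne_tau DihedralLikeGroup.rho_or_tau hmodB hB h' hV'
    obtain ⟨g, rfl⟩ := hπsurj gbar
    -- `A = {0, a, -c₀, a - c₀} + ⟨g⟩`
    have hlift : ∀ y : A, π y ∈ AddSubgroup.zmultiples (π g) →
        y ∈ AddSubgroup.zmultiples g ∨ y - a ∈ AddSubgroup.zmultiples g := by
      intro y hy
      obtain ⟨k, hk⟩ := AddSubgroup.mem_zmultiples_iff.1 hy
      have h0 : π (y - k • g) = 0 := by rw [map_sub, map_zsmul, hk, sub_self]
      rcases (hker _).1 h0 with h1 | h1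
      · left; exact AddSubgroup.mem_zmultiples_iff.2 ⟨k, by rw [sub_eq_zero] at h1; exact h1.symm⟩
      · right
        refine AddSubgroup.mem_zmultiples_iff.2 ⟨k, ?_⟩
        rw [← h1]; abel
    refine psi_not_onto_of_four_cosets (g := g) (a := a) (c := c₀) ψ₁ ψ₂ ψ₃ hψc (fun x => ?_) hψ
    rcases hgbar (π x) with hx | hx
    · rcases hlift x hx with h1 | h1
      · exact Or.inl h1
      · exact Or.inr (Or.inl h1)
    · rw [hc₀', ← map_add] at hx
      rcases hlift (x + c₀) hx with h1 | h1
      · exact Or.inr (Or.inr (Or.inl h1))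
      · exact Or.inr (Or.inr (Or.inr h1))

/-- **The reduction theorem.**  Dicyclic type `G(A, c₀)` (`c₀ ≠ 0`), `|A| ≡ 2 (mod 3)`, `|A| ≥ 28`, `A/⟨c₀⟩ ↠ 𝔽₂³` (three
homomorphisms `A →+ ZMod 2` killing `c₀`, jointly onto).  A TPP triple with a member stable under right multiplication by some
central involution `ρ(a)` (`2a = 0 ≠ a`) does not attain `3|S||T||U| + 16 = 8|A|`.  Hence the '⟹' half of the classification
for the census families `C₂² × Q_{4m}`, `C₂² × (ℤ_n ⋊ ℤ₄)`, `C₂³ × Q_{4m}` follows from the stability statement (H) of the module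
docstring. [folklore] -/
theorem no_dicyclic_law_of_stable_member
    (hρρ : ∀ a b, ρ a * ρ b = ρ (a + b)) (hρτ : ∀ a b, ρ a * τ b = τ (b - a))
    (hτρ : ∀ a b, τ a * ρ b = τ (a + b)) (hττ : ∀ a b, τ a * τ b = ρ (c₀ + b - a)) (hc₀ : c₀ ≠ 0)
    (hρ : Function.Injective ρ) (hτ : Function.Injective τ) (hne : ∀ a b, ρ a ≠ τ b)
    (hsurj : ∀ g, (∃ a, ρ a = g) ∨ (∃ a, τ a = g)) (hmod : Fintype.card A % 3 = 2) (hA : 28 ≤ Fintype.card A)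
    (ψ₁ ψ₂ ψ₃ : A →+ ZMod 2) (hψc : ψ₁ c₀ = 0 ∧ ψ₂ c₀ = 0 ∧ ψ₃ c₀ = 0)
    (hψ : ∀ v : ZMod 2 × ZMod 2 × ZMod 2, ∃ x, (ψ₁ x, ψ₂ x, ψ₃ x) = v)
    {S T U : Finset G} (h : TripleProductProperty S T U)
    {a : A} (ha2 : a + a = 0) (ha0 : a ≠ 0)
    (hstab : (∀ x ∈ S, x * ρ a ∈ S) ∨ (∀ x ∈ T, x * ρ a ∈ T) ∨ (∀ x ∈ U, x * ρ a ∈ U)) :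
    3 * (S.card * T.card * U.card) + 16 ≠ 8 * Fintype.card A := by
  rcases hstab with hSa | hTa | hUa
  · -- rotate `(S, T, U) ↦ (T, U, S)`
    have key := no_dicyclic_law_of_stable_third hρρ hρτ hτρ hττ hc₀ hρ hτ hne hsurj hmod hA ψ₁ ψ₂ ψ₃ hψc hψ
      h.rotate ha2 ha0 hSa
    rwa [show T.card * U.card * S.card = S.card * T.card * U.card by ring] at key
  · have key := no_dicyclic_law_of_stable_third hρρ hρτ hτρ hττ hc₀ hρ hτ hne hsurj hmod hA ψ₁ ψ₂ ψ₃ hψc hψ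
      h.rotate.rotate ha2 ha0 hTa
    rwa [show U.card * S.card * T.card = S.card * T.card * U.card by ring] at key
  · exact no_dicyclic_law_of_stable_third hρρ hρτ hτρ hττ hc₀ hρ hτ hne hsurj hmod hA ψ₁ ψ₂ ψ₃ hψc hψ h ha2 ha0 hUa

/-- **Two-domino case, re-derived from the reduction** (saturation makes `U ∪ Uρ(c₀)` a `ρ(c₀)`-stable member without losing
volume): no two-domino dicyclic-law triple when `A/⟨c₀⟩ ↠ 𝔽₂³` — the same statement as
`no_two_domino_dicyclic_law_of_rank_three`, with the surjection `π` replaced by the three characters of `A`. [folklore] -/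
theorem no_dicyclic_law_of_two_domino'
    (hρρ : ∀ a b, ρ a * ρ b = ρ (a + b)) (hρτ : ∀ a b, ρ a * τ b = τ (b - a))
    (hτρ : ∀ a b, τ a * ρ b = τ (a + b)) (hττ : ∀ a b, τ a * τ b = ρ (c₀ + b - a)) (hc₀ : c₀ ≠ 0)
    (hρ : Function.Injective ρ) (hτ : Function.Injective τ) (hne : ∀ a b, ρ a ≠ τ b)
    (hsurj : ∀ g, (∃ a, ρ a = g) ∨ (∃ a, τ a = g)) (hmod : Fintype.card A % 3 = 2) (hA : 28 ≤ Fintype.card A)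
    (ψ₁ ψ₂ ψ₃ : A →+ ZMod 2) (hψc : ψ₁ c₀ = 0 ∧ ψ₂ c₀ = 0 ∧ ψ₃ c₀ = 0)
    (hψ : ∀ v : ZMod 2 × ZMod 2 × ZMod 2, ∃ x, (ψ₁ x, ψ₂ x, ψ₃ x) = v)
    {S T U : Finset G} (h : TripleProductProperty S T U)
    (hs₀ : (univ.filter fun a : A => ρ a ∈ S).card = 1) (hs₁ : (univ.filter fun a : A => τ a ∈ S).card = 1)
    (ht₀ : (univ.filter fun a : A => ρ a ∈ T).card = 1) (ht₁ : (univ.filter fun a : A => τ a ∈ T).card = 1) :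
    3 * (S.card * T.card * U.card) + 16 ≠ 8 * Fintype.card A := by
  intro hV
  have h2c₀ : c₀ + c₀ = 0 := two_c0_eq_zero hρτ hτρ hττ hτ
  set z : G := ρ c₀ with hz
  have hzc : ∀ g, Commute z g := commute_rho_c0 hρρ hρτ hτρ hττ hτ hsurj
  have hzz : z * z = 1 := rho_c0_mul_self hρρ hρτ hτρ hττ hτ
  have hsat := tpp_saturate hzc hzz (domino_quot_stable hρρ hρτ hτρ hττ hτ hne hsurj hs₀ hs₁)
    (domino_quot_stable hρρ hρτ hτρ hττ hτ hne hsurj ht₀ ht₁) h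
  have hU₂z : ∀ u ∈ U ∪ U.image (· * z), u * ρ c₀ ∈ U ∪ U.image (· * z) := by
    intro u hu
    rcases mem_union.1 hu with hu | hu
    · exact mem_union_right _ (mem_image_of_mem _ hu)
    · obtain ⟨u', hu', rfl⟩ := mem_image.1 hu
      rw [← hz, mul_assoc, hzz, mul_one]; exact mem_union_left _ hu'
  have hne' := no_dicyclic_law_of_stable_member hρρ hρτ hτρ hττ hc₀ hρ hτ hne hsurj hmod hA ψ₁ ψ₂ ψ₃ hψc hψ hsat h2c₀ hc₀
    (Or.inr (Or.inr hU₂z))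
  have hle := tpp_volume_le_law_dicyclicLike hρρ hρτ hτρ hττ hρ hτ hne hsurj h2c₀ hc₀ hmod (by omega) hsat
  have hmono : U.card ≤ (U ∪ U.image (· * z)).card := card_le_card subset_union_left
  have : S.card * T.card * U.card ≤ S.card * T.card * (U ∪ U.image (· * z)).card := Nat.mul_le_mul_left _ hmono
  omega

end Reduction

end Summit.MatrixMultiplication.OmegaCensus
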